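import Literature.NumberTheory.GaloisRepresentations.RestrictedRamification
import Literature.NumberTheory.GaloisRepresentations.CyclotomicLevels
import Literature.NumberTheory.GaloisRepresentations.KummerGalFixing
import HarnessLib

/-!
# `μ_N ⊆ K_S` for `S ⊇ supp N`, and Kummer theory on the ramification subgroup `N_S = Gal(K̄/K_S)`

Let `K` be a number field, `S` a set of finite places, `N_S ≤ Γ_K` the ramification subgroup
outside `S` (`ramificationSubgroup K S`: the closed normal subgroup generated by the inertia
groups above the places `v ∉ S`, `RestrictedRamification.lean`), so that `K_S = K̄^{N_S}` is the
maximal extension of `K` unramified outside `S` and `G_{K,S} = Γ_K/N_S`.  For `N ≥ 1`: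

* §1 `ramificationSubgroup_le_rootsOfUnityFixer` — **if every finite place dividing
  `N` lies in `S`, then `N_S ≤ Gal(K̄/K(μ_N)) = ker χ_N`** (tree `rootsOfUnityFixer`, `CyclotomicLevels.lean`): the mod-`N` cyclotomic character is unramified outside
  `N` (tree `modNCyclotomicCharacter_eq_one_of_mem_inertia`, Neukirch I (10.3)–(10.4) /
  Washington Prop. 2.3) and has open kernel, so the universal property of `N_S`
  (`ramificationSubgroup_le_ker`) applies; so every `σ ∈ N_S` fixes every `ζ ∈ K̄` with `ζ^N = 1`
  (`smul_units_eq_self_of_mem_ramificationSubgroup`; the `p`-power case is also the tree's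
  `smul_eq_self_of_mem_ramificationSubgroup_of_pow_eq_one` of `UnramifiedRadicalDescentAbsolute.lean`,
  proved via inertia rather than `χ_N`), i.e. **`μ_N(K̄) ⊆ K_S`** ("`K(μ_N)/K` is unramified outside `N·∞`",
  Neukirch–Schmidt–Wingberg VIII §3 standing remark; at `N = p^m`: `S ⊇ S_p ⇒ μ_{p^∞} ⊂ K_S`).
* §2 `ramificationSubgroup.exists_kummer_of_hom` — **Kummer theory on `N_S`** (with
  `S ⊇ supp N`): every exponent-`N` multiplicative map `χ : N_S → K̄ˣ` with open kernel-set (a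
  continuous homomorphism `N_S → μ_N`) is `σ ↦ σ(β)/β` for a unit `β ∈ K̄ˣ` whose `N`-th power
  is `N_S`-invariant (`β^N ∈ K_Sˣ`): `Hom_cont(N_S, μ_N) = H¹(K_S, μ_N) = K_Sˣ/K_Sˣᴺ` at the level
  of homomorphisms — the instance `H = N_S` of `exists_kummer_of_hom_of_isClosed`
  (`KummerGalFixing.lean`, Serre X §3 b)) with §1 supplying the trivial action; and the cocycle
  twin `ramificationSubgroup.exists_kummer_of_cocycle` (no hypothesis on `S`).

This is the input "(KUM)" of the inflation–restriction analysis of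
`ker(H²(G_{K,S}, μ_{p^m}) → H²(Γ_F, μ_{p^m}))` (Neukirch–Schmidt–Wingberg (8.3.x), Hochschild–Serre
transgression with `H¹(N_S, μ_{p^m})^{G}`), used towards the weak Leopoldt conjecture for the
cyclotomic `ℤ_p`-extension.  Theorems only; no definition, no named fact, no instance.

## References
* [NeukirchSchmidtWingberg2008] J. Neukirch, A. Schmidt, K. Wingberg, *Cohomology of Number
  Fields*, 2nd ed. (2008), VIII §3 (`G_S`, `𝒪_S`-Kummer theory; `μ_{p^∞} ⊂ k_S` for `S ⊇ S_p ∪ S_∞`).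
* [SerreLocalFields1979] J.-P. Serre, *Local Fields* (1979), X §3 b) (Kummer theory).
* [Washington1997] L. C. Washington, *Introduction to Cyclotomic Fields*, 2nd ed., Prop. 2.3
  (`p ∤ N` unramified in `ℚ(ζ_N)`).
-/

noncomputable section

open scoped NumberField Pointwise
open Field IsDedekindDomain Topology

universe u

namespace Literature.NumberTheory.GaloisRepresentations

open LocalWeilDatum

variable (K : Type u) [Field K] [NumberField K] (S : Set (HeightOneSpectrum (𝓞 K)))
variable (N : ℕ) [NeZero N]

/-! ### §1. `N_S` acts trivially on `μ_N` when `S ⊇ supp N` -/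

/-- **`N_S ≤ Gal(K̄/K(μ_N))` for `S ⊇ supp N`.**  If every finite place of `K` dividing `N` lies in
`S`, the ramification subgroup `N_S` fixes the `N`-th roots of unity (tree `rootsOfUnityFixer K N`
= `ker χ_N`, `CyclotomicLevels.lean`): the mod-`N` cyclotomic character has open kernel and is
trivial on the inertia groups above the places `v ∤ N` (`modNCyclotomicCharacter_eq_one_of_mem_inertia`:
`K(μ_N)/K` is unramified outside `N`), so the universal property `ramificationSubgroup_le_ker`
applies.  I.e. **`K(μ_N) ⊆ K_S`**.
[cite: NeukirchSchmidtWingberg2008, VIII §3] [cite: Washington1997, Prop. 2.3] -/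
theorem ramificationSubgroup_le_rootsOfUnityFixer
    (hS : ∀ v : HeightOneSpectrum (𝓞 K), ((N : ℕ) : 𝓞 K) ∈ v.asIdeal → v ∈ S) :
    ramificationSubgroup K S ≤ rootsOfUnityFixer K N := by
  rw [rootsOfUnityFixer_eq_ker]
  refine ramificationSubgroup_le_ker (modNCyclotomicCharacter K N)
    (by rw [← rootsOfUnityFixer_eq_ker]; exact isOpen_rootsOfUnityFixer K N)
    fun v hv 𝔓 h𝔓 σ hσ => ?_
  haveI : 𝔓.IsPrime := (HeightOneSpectrum.mem_primesAbove_iff.mp h𝔓).1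
  exact modNCyclotomicCharacter_eq_one_of_mem_inertia
    (natCast_not_mem_of_mem_primesAbove K (fun h => hv (hS v h)) h𝔓) hσ

variable {K S N} in
/-- Units form of `ramificationSubgroup_le_rootsOfUnityFixer`: under `S ⊇ supp N`, `N_S` fixes
every `ζ ∈ K̄ˣ` with `ζ ^ N = 1` (the hypothesis `hμ` of `exists_kummer_of_hom_of_isClosed` at
`H = N_S`; the `p`-power case `N = p^m`, `S ⊇ S_p` is also the tree's
`smul_eq_self_of_mem_ramificationSubgroup_of_pow_eq_one`, `UnramifiedRadicalDescentAbsolute.lean`).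
[cite: NeukirchSchmidtWingberg2008, VIII §3] -/
theorem smul_units_eq_self_of_mem_ramificationSubgroup
    (hS : ∀ v : HeightOneSpectrum (𝓞 K), ((N : ℕ) : 𝓞 K) ∈ v.asIdeal → v ∈ S)
    (ζ : (AlgebraicClosure K)ˣ) (hζ : ζ ^ N = 1)
    (σ : absoluteGaloisGroup K) (hσ : σ ∈ ramificationSubgroup K S) :
    σ • (ζ : AlgebraicClosure K) = ζ :=
  mem_rootsOfUnityFixer_iff.mp (ramificationSubgroup_le_rootsOfUnityFixer K S N hS hσ) _
    (by rw [← Units.val_pow_eq_pow_val, hζ, Units.val_one])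

/-! ### §2. Kummer theory on `N_S` -/

omit [NeZero N] in
/-- **Kummer theory on the ramification subgroup, cocycle form** (no hypothesis on `S`): a
multiplicative `1`-cocycle `c : N_S → K̄ˣ`, `c (g h) = c g · g • c h`, with open kernel-set and
`cᴺ = 1` is `g ↦ g • β / β` with `βᴺ` invariant under `N_S` (`βᴺ ∈ K_Sˣ`) — the instance `H = N_S`
(closed) of `exists_kummer_of_cocycle_of_isClosed`, `K̄/K` being Galois in characteristic `0`.
[cite: SerreLocalFields1979, X §3 b)] -/
theorem ramificationSubgroup.exists_kummer_of_cocycle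
    (c : ramificationSubgroup K S → (AlgebraicClosure K)ˣ)
    (hcoc : ∀ g h, c (g * h) = c g * (g : absoluteGaloisGroup K) • c h)
    (hopen : IsOpen {g | c g = 1}) (hn : ∀ g, c g ^ N = 1) :
    ∃ β : (AlgebraicClosure K)ˣ,
      (∀ g : ramificationSubgroup K S, (g : absoluteGaloisGroup K) • β ^ N = β ^ N) ∧
      ∀ g, c g = (g : absoluteGaloisGroup K) • β / β := by
  haveI : IsGalois K (AlgebraicClosure K) := {}
  exact exists_kummer_of_cocycle_of_isClosed N (ramificationSubgroup K S)
    (ramificationSubgroup_isClosed K S) c hcoc hopen hn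

/-- **Kummer theory on the ramification subgroup, homomorphism form ("(KUM)")**: if every finite
place dividing `N` lies in `S` (so `μ_N ⊆ K_S` and `N_S` acts trivially on `μ_N`, §1), every
multiplicative `χ : N_S → K̄ˣ` with open kernel-set and `χᴺ = 1` — a continuous homomorphism
`N_S → μ_N` — is `σ ↦ σ(β)/β` for a unit `β ∈ K̄ˣ` with `βᴺ` invariant under `N_S`, i.e.
`βᴺ ∈ K_Sˣ`: `Hom_cont(Gal(K̄/K_S), μ_N) = K_Sˣ/K_Sˣᴺ` at the level of homomorphisms.
[cite: SerreLocalFields1979, X §3 b)] [cite: NeukirchSchmidtWingberg2008, VIII §3] -/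
theorem ramificationSubgroup.exists_kummer_of_hom
    (hS : ∀ v : HeightOneSpectrum (𝓞 K), ((N : ℕ) : 𝓞 K) ∈ v.asIdeal → v ∈ S)
    (χ : ramificationSubgroup K S → (AlgebraicClosure K)ˣ) (hmul : ∀ g h, χ (g * h) = χ g * χ h)
    (hopen : IsOpen {g | χ g = 1}) (hn : ∀ g, χ g ^ N = 1) :
    ∃ β : (AlgebraicClosure K)ˣ,
      (∀ g : ramificationSubgroup K S, (g : absoluteGaloisGroup K) • β ^ N = β ^ N) ∧
      ∀ g, χ g = (g : absoluteGaloisGroup K) • β / β := by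
  haveI : IsGalois K (AlgebraicClosure K) := {}
  exact exists_kummer_of_hom_of_isClosed N (ramificationSubgroup K S)
    (ramificationSubgroup_isClosed K S)
    (fun ζ hζ σ hσ => smul_units_eq_self_of_mem_ramificationSubgroup hS ζ hζ σ hσ)
    χ hmul hopen hn

/-- The same with the fixed field made explicit: under `S ⊇ supp N`, for every exponent-`N`
continuous homomorphism `χ : N_S → K̄ˣ` there are a subextension `F` of `K̄/K` with
`Gal(K̄/F) = N_S` (namely `F = K_S`), a unit `β` and `b ∈ F` with `βᴺ = b` and `χ = (σ ↦ σ(β)/β)`.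
[cite: SerreLocalFields1979, X §3 b)] -/
theorem ramificationSubgroup.exists_kummer_of_hom_fixedField
    (hS : ∀ v : HeightOneSpectrum (𝓞 K), ((N : ℕ) : 𝓞 K) ∈ v.asIdeal → v ∈ S)
    (χ : ramificationSubgroup K S → (AlgebraicClosure K)ˣ) (hmul : ∀ g h, χ (g * h) = χ g * χ h)
    (hopen : IsOpen {g | χ g = 1}) (hn : ∀ g, χ g ^ N = 1) :
    ∃ (F : IntermediateField K (AlgebraicClosure K)) (β : (AlgebraicClosure K)ˣ) (b : F),
      galFixing K F = ramificationSubgroup K S ∧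
      algebraMap F (AlgebraicClosure K) b = (β : AlgebraicClosure K) ^ N ∧
      ∀ g, χ g = (g : absoluteGaloisGroup K) • β / β := by
  haveI : IsGalois K (AlgebraicClosure K) := {}
  have htriv : ∀ (g : ramificationSubgroup K S) (h : ramificationSubgroup K S),
      (g : absoluteGaloisGroup K) • χ h = χ h := fun g h => by
    apply Units.ext
    rw [Units.coe_smul]
    exact smul_units_eq_self_of_mem_ramificationSubgroup hS (χ h) (hn h) _ g.2
  exact exists_kummer_of_cocycle_of_isClosed_charZero N (ramificationSubgroup K S)
    (ramificationSubgroup_isClosed K S) χ (fun g h => by rw [hmul, htriv]) hopen hn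

/-! ### §3. Bundled form: continuous `1`-cocycles of the restricted Kummer module on a closed `H` / on `N_S` -/

section Bundled

open DiscreteGaloisModule

variable {K} in
omit [NeZero N] in
/-- **Every continuous `1`-cocycle of a closed `H ≤ Γ_K` in `μ_N` is a Kummer cocycle** — bundled
form over the tree's `contOneCocycles` of the restricted Kummer module
`(mu K N).restrict (subgroupIncl H)` (the currency of `KummerSES.IsSES.res`): there is `β ∈ K̄ˣ`
with `βᴺ` invariant under `H` and `muVal (φ g) = g • β / β` for all `g ∈ H`.  (The case
`H = galFixing K F` is `galFixing.exists_kummer_eq_contOneCocycle`, `KummerGalFixing.lean`.)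
[cite: SerreLocalFields1979, X §3 b)] -/
theorem exists_kummer_eq_contOneCocycle_of_isClosed (H : Subgroup (absoluteGaloisGroup K))
    (hH : IsClosed (H : Set (absoluteGaloisGroup K)))
    (φ : contOneCocycles (((mu K N).restrict (subgroupIncl H)).toTopRep)) :
    ∃ β : (AlgebraicClosure K)ˣ,
      (∀ g : H, (g : absoluteGaloisGroup K) • β ^ N = β ^ N) ∧
      ∀ g, muVal K N (φ.1 g) = (g : absoluteGaloisGroup K) • β / β := by
  haveI : IsGalois K (AlgebraicClosure K) := {}
  let c : H → (AlgebraicClosure K)ˣ := fun g => muVal K N (φ.1 g)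
  have hcoc : ∀ g h, c (g * h) = c g * (g : absoluteGaloisGroup K) • c h := by
    intro g h
    have h1 := congrArg (muVal K N) (φ.2 g h)
    rw [muVal_add] at h1
    exact h1
  have hopen : IsOpen {g | c g = 1} := by
    have h0 : {g | c g = 1} = φ.1 ⁻¹' {0} := by
      ext g
      simp only [Set.mem_setOf_eq, Set.mem_preimage, Set.mem_singleton_iff, c]
      rw [← muVal_zero K N]
      exact (muVal_injective K N).eq_iff
    rw [h0]
    exact (isOpen_discrete _).preimage φ.1.continuous
  have hn : ∀ g, c g ^ N = 1 := fun g => muVal_pow_eq_one K N _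
  exact exists_kummer_of_cocycle_of_isClosed N H hH c hcoc hopen hn

omit [NeZero N] in
/-- **Kummer theory on `N_S`, bundled cocycle form ("(KUM)" in the currency `Z¹(N_S, μ_N)`)**: every
continuous `1`-cocycle `φ` of the ramification subgroup `N_S = Gal(K̄/K_S)` with values in the
restricted Kummer module `(mu K N).restrict (subgroupIncl N_S)` satisfies
`muVal (φ n) = n • β / β` for a unit `β ∈ K̄ˣ` with `βᴺ` invariant under `N_S` (`βᴺ ∈ K_Sˣ`).  No
hypothesis on `S` (the cocycle form does not need the trivial action).
[cite: SerreLocalFields1979, X §3 b)] [cite: NeukirchSchmidtWingberg2008, VIII §3] -/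
theorem ramificationSubgroup.exists_kummer_eq_contOneCocycle
    (φ : contOneCocycles
      (((mu K N).restrict (subgroupIncl (ramificationSubgroup K S))).toTopRep)) :
    ∃ β : (AlgebraicClosure K)ˣ,
      (∀ g : ramificationSubgroup K S, (g : absoluteGaloisGroup K) • β ^ N = β ^ N) ∧
      ∀ g, muVal K N (φ.1 g) = (g : absoluteGaloisGroup K) • β / β :=
  exists_kummer_eq_contOneCocycle_of_isClosed N (ramificationSubgroup K S)
    (ramificationSubgroup_isClosed K S) φ

end Bundled

end Literature.NumberTheory.GaloisRepresentations

end
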